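import Summits.ResolutionOfSingularities.ResolutionOfSingularities.Theorems.WeightedInvariantHypersurfaceLocalGameEFT4SDimLE
import Summits.ResolutionOfSingularities.ResolutionOfSingularities.Theorems.WeightedInvariantHypersurfaceLocalGameEFT4SDimLETwoRung
import HarnessLib

/-!
# The second rung of the position-dimension ladder IS CLOSED for `(iotaOrd, jContact)`: `PRung 2 p iotaOrd jContact`
# (door `HypersurfaceCentreConstruction`, stmt-ResolutionOfSingularities-19897, line `local-engine`; ORDER (o29) transfer)

Kernel bookkeeping, no mathematics: res-type-073's P2 rung of record `stub_keyRung_dimLETwo : ∀ p, p.Prime →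
P2Rung p iotaOrd jContact` (`…HypersurfaceLocalGameEFT4SDimLETwoRung`, p521487) transferred to the parametric ladder
`PRung d` of `…HypersurfaceLocalGameEFT4SDimLE` (ORDER (o29), res-type-061) through the definitional seam `pRung_two_iff`,
plus the rungs below it (`d ≤ 2`, by `pRung_mono`) and the ∃-closed form `LocalWeightedDropEFT4SDimLE d p` for `d ≤ 2`.

[OURS · L1 W4.3 · kernel bookkeeping; nothing here asserts anything about Hironaka's problem; NOT a statement of the
manuscript under review (Hironaka 2017, [claim: Hironaka2017, status: under-review]); AI work, weaker than expert review.]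
-/

set_option linter.dupNamespace false

noncomputable section

open IsLocalRing Literature.AlgebraicGeometry.Resolution
open Summit.ResolutionOfSingularities.ResolutionOfSingularities.Theorems

namespace Summit.ResolutionOfSingularities.ResolutionOfSingularities.Cruxes.HypersurfaceCentreConstruction.LocalEngine

/-- **Rung `d = 2` of the ladder for the pair of record `(iotaOrd, jContact)`**: `PRung 2 p iotaOrd jContact` for every
prime `p` — res-type-073's `stub_keyRung_dimLETwo` read through `pRung_two_iff`. [OURS · L1 W4.3 · ORDER (o29) transfer] -/
theorem pRung_two_iotaOrd_jContact : ∀ p : ℕ, p.Prime → PRung 2 p iotaOrd jContact :=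
  fun p hp => (pRung_two_iff p iotaOrd jContact).mpr (stub_keyRung_dimLETwo p hp)

/-- **Every rung `d ≤ 2` of the ladder is closed for `(iotaOrd, jContact)`** (P0, P1, P2; `pRung_mono`).
[OURS · L1 W4.3 · ORDER (o29) transfer] -/
theorem pRung_iotaOrd_jContact_of_le_two {d : ℕ} (hd : d ≤ 2) : ∀ p : ℕ, p.Prime → PRung d p iotaOrd jContact :=
  fun p hp => pRung_mono hd p iotaOrd jContact (pRung_two_iotaOrd_jContact p hp)

/-- The ∃-closed rung `LocalWeightedDropEFT4SDimLE d p` holds for every `d ≤ 2` and every prime `p`, witnessed by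
`(iotaOrd, jContact)`. [OURS · L1 W4.3 · ORDER (o29) transfer] -/
theorem localWeightedDropEFT4SDimLE_of_le_two {d : ℕ} (hd : d ≤ 2) (p : ℕ) (hp : p.Prime) :
    LocalWeightedDropEFT4SDimLE d p :=
  ⟨iotaOrd, jContact, pRung_iotaOrd_jContact_of_le_two hd p hp⟩

end Summit.ResolutionOfSingularities.ResolutionOfSingularities.Cruxes.HypersurfaceCentreConstruction.LocalEngine

end
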